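import Mathlib
import HarnessLib

/-!
# QUANT lane R8, front "FAR beyond trees", layer one on hairy cycles — the ONE-SIDED PAIRS SYSTEM and the regime-B lemma (ΩB*)

builds on p205010 (kernel theorem, internal audit signed; external expert review pending)

Support file (`--supports stmt-CriticalPhenomena-4575`), seat `prim-quant-p1` (gen 17); memo
`run/shared/lean/prim/quant/prim-quant-p1-g17/FOR-LEAD-TWOCHAIN-B.md` §1–§3 (and g16's `FOR-LEAD-TWOCHAIN-A.md` §4 for the coordinates).
Pure real algebra on lists; standard axioms; no sorries.  Target served: the law-level row `HairyCycle.SunFAR K 1`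
(`…QuantFarSunLawDefs`, prim-cert-1 g20) — FAR at layer one on every hairy cycle — through the two-arc (two-chain) lemmas.

**The abstract one-sided pairs system** (g16 §4(a)).  The distinguished relay `a` sits at position 1 of the two-chain OR model with a
sure hair; `p = 1 − α₁` (the boost fails), `c₁ = 1 − β₁`, so `x = P(a reached) = 1 − p c₁`.  A COMPANION `k` (listed nearest-first) is
the 4-tuple `(A, c, T, u)`: prefix drop `A = α₁ − α_k ∈ [0, 1 − p]` (non-decreasing along the list), suffix failure `c = 1 − β_k ∈ [0, c₁]`,
marginal `T = h_k ρ_k ≥ x` of the relay (`ρ_k = 1 − (p + A) c`), and hair odds `u = h_k/(1 − h_k) ≥ 0`, tied to `T` by `u (ρ_k − T) = T`.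
Derived: `d_k = ρ_k − x = p (c₁ − c) − A c`, `e_k = A c` (= P(a covered, k uncovered)), pair value `Φ_jk = d_j + A_j (c_j − c_k)` (j nearer).
List functionals: `Π = Σ_{j<k} u_j u_k Φ_jk` (`piS`), `ℬ = Σ u_k e_k` (`bS`), `σ = Σ T_k` (`sigS`), `E = Σ u_k (T_k − x)` (`eS`), and
  `M = (1 − x) Π + (1 − σ) E − (σ − x)(x + ℬ)`  (`omegaM`).
* `Quant.TwoArc.omegaM_nonneg` — **LEMMA (ΩB\*)**: for `0 ≤ p ≤ 1`, `0 ≤ c₁ ≤ 1`, a non-empty admissible list with `A` non-decreasing and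
  `σ ≤ 1` (regime B):  `0 ≤ M`.  Equivalently `(1−x)(Π − ℬ − x) + (1−σ)(P − σ + x) ≥ 0` with `P = Σ u_k (d_k + e_k)`; at `σ = 1` it is the
  one-sided pairs inequality (P1) `Π ≥ x + ℬ` of g15/g16, at a single tied companion it is an equality.  PROOF (memo §3): induction on the list
  removing the NEAREST companion; `omegaM_cons` (the recursion `M(k::ks) = M(ks) + u_k J − T_k C`), `step_identity`
  (`J − r C = Q₀ + (T−x)((1−σ) + (C − e))`), `tied_removal_nonneg` (`Q₀ ≥ 0`: per companion the identity `compTerm_eq` and three products of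
  non-negative factors; the one use of subcriticality is `p ≥ A` from `2x ≤ σ ≤ 1`), `omegaM_singleton` (base `M = (T−x)(u p c + T − x)`).
* `Quant.TwoArc.twoSided_coupling` — the TWO-SIDED COUPLING of memo §2, as real algebra: from the two (ΩB\*) margins of the left and right
  subsystems (`x ≤ σ_S < 1`, `σ_L + σ_R ≥ 1`, `P_S ≥ σ_S`) the two-sided pairs polynomial `Ω_L + Ω_R + P_L P_R/(1−x)` is `≥ x`; and
  `twoSided_coupling_super` — the supercritical-side case (`Ω_R ≥ x`, `P_R ≥ 1` ⟹ the same).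
What is NOT here (next files): g16's one-sided regime-A theorem (P1) in this vocabulary; the dictionary `sunLaw ↔ (p, c₁, companions)` and the
pairs lower bound `P(N ≥ 2) − x ≥ Z·(Π − ℬ − x)` (STEP 1); the tied-random distinguished relay (open on paper, memo §5).
Numerical/exact re-check of every identity below: memo `num/proofcheck_omb.py` (0 violations).  Nearest prior art searched 2026-08-21
(corpus hybrid "probability at least two of dependent events lower bound union of two monotone chains", vsearch "second occurring relay two routes
cycle percolation layer one", galaxy "two-chain|second weight|at least two successes"): nothing closer than the lane's own chain lemmas; [this work].
-/

namespace Summit.CriticalPhenomena.PercolationContinuityZ3.Theorems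

namespace Quant

namespace TwoArc

/-- A companion of the one-sided pairs system: prefix drop `A = α₁ − α_k`, suffix failure `c = 1 − β_k`, marginal `T = h_k ρ_k`,
hair odds `u = h_k/(1 − h_k)`. [this work] -/
structure Comp where
  /-- prefix drop `α₁ − α_k` -/
  A : ℝ
  /-- suffix failure `1 − β_k` -/
  c : ℝ
  /-- marginal of the relay `h_k ρ_k` -/
  T : ℝ
  /-- odds of the hair `h_k / (1 − h_k)` -/
  u : ℝ

variable (p c₁ : ℝ)

/-- The distinguished relay's marginal `x = 1 − p c₁`. [this work] -/
def xv : ℝ := 1 - p * c₁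

namespace Comp

/-- Coverage probability of the companion's position `ρ_k = 1 − (p + A) c`. [this work] -/
def rho (k : Comp) : ℝ := 1 - (p + k.A) * k.c

/-- `d_k = ρ_k − x = p (c₁ − c) − A c`. [this work] -/
def d (k : Comp) : ℝ := p * (c₁ - k.c) - k.A * k.c

/-- `e_k = A c` = P(`a` covered, `k` uncovered). [this work] -/
def e (k : Comp) : ℝ := k.A * k.c

/-- Pair value `Φ_jk = d_j + A_j (c_j − c_k)` for `j` nearer than `k` (= P(N ≥ 2 | exactly `j,k` open) − x). [this work] -/
def phi (j k : Comp) : ℝ := j.d p c₁ + j.A * (j.c - k.c)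

/-- Admissibility of a companion at `(p, c₁)`: the box constraints of the two-chain model, `T ≥ x`, `T ≤ ρ`, and the odds relation
`u (ρ − T) = T`. [this work] -/
structure Adm (k : Comp) : Prop where
  A_nonneg : 0 ≤ k.A
  A_le : k.A ≤ 1 - p
  c_nonneg : 0 ≤ k.c
  c_le : k.c ≤ c₁
  u_nonneg : 0 ≤ k.u
  x_le_T : xv p c₁ ≤ k.T
  T_le_rho : k.T ≤ k.rho p
  odds : k.u * (k.rho p - k.T) = k.T

end Comp

/-- Pair income of `k` from the later (farther) companions `ks`: `I_k = Σ_{l ∈ ks} u_l Φ_kl`. [this work] -/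
def inc (k : Comp) (ks : List Comp) : ℝ := (ks.map fun l => l.u * Comp.phi p c₁ k l).sum

/-- Pair sum `Π = Σ_{j<k} u_j u_k Φ_jk` of a nearest-first list. [this work] -/
def piS : List Comp → ℝ
  | [] => 0
  | k :: ks => piS ks + k.u * inc p c₁ k ks

/-- Singleton sum `ℬ = Σ u_k e_k`. [this work] -/
def bS (ks : List Comp) : ℝ := (ks.map fun k => k.u * k.e).sum

/-- Mass `σ = Σ T_k`. [this work] -/
def sigS (ks : List Comp) : ℝ := (ks.map fun k => k.T).sum

/-- Excess `E = Σ u_k (T_k − x)` (= `Σ u_k d_k − σ` under the odds relation). [this work] -/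
def eS (ks : List Comp) : ℝ := (ks.map fun k => k.u * (k.T - xv p c₁)).sum

/-- The (ΩB\*) functional `M = (1 − x) Π + (1 − σ) E − (σ − x)(x + ℬ)`. [this work] -/
def omegaM (ks : List Comp) : ℝ :=
  (1 - xv p c₁) * piS p c₁ ks + (1 - sigS ks) * eS p c₁ ks - (sigS ks - xv p c₁) * (xv p c₁ + bS ks)

variable {p c₁}

section lemmas

/-- `I_k` over the empty list. [this work] -/
@[simp] theorem inc_nil (k : Comp) : inc p c₁ k [] = 0 := by simp [inc]
/-- `I_k` recursion. [this work] -/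
@[simp] theorem inc_cons (k l : Comp) (ls : List Comp) :
    inc p c₁ k (l :: ls) = l.u * Comp.phi p c₁ k l + inc p c₁ k ls := by simp [inc]
/-- `Π` of the empty list. [this work] -/
@[simp] theorem piS_nil : piS p c₁ [] = 0 := rfl
/-- `Π` recursion (nearest companion first). [this work] -/
@[simp] theorem piS_cons (k : Comp) (ks : List Comp) : piS p c₁ (k :: ks) = piS p c₁ ks + k.u * inc p c₁ k ks := rfl
/-- `ℬ` of the empty list. [this work] -/
@[simp] theorem bS_nil : bS [] = 0 := by simp [bS]
/-- `ℬ` recursion. [this work] -/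
@[simp] theorem bS_cons (k : Comp) (ks : List Comp) : bS (k :: ks) = k.u * k.e + bS ks := by simp [bS]
/-- `σ` of the empty list. [this work] -/
@[simp] theorem sigS_nil : sigS [] = 0 := by simp [sigS]
/-- `σ` recursion. [this work] -/
@[simp] theorem sigS_cons (k : Comp) (ks : List Comp) : sigS (k :: ks) = k.T + sigS ks := by simp [sigS]
/-- `E` of the empty list. [this work] -/
@[simp] theorem eS_nil : eS p c₁ [] = 0 := by simp [eS]
/-- `E` recursion. [this work] -/
@[simp] theorem eS_cons (k : Comp) (ks : List Comp) : eS p c₁ (k :: ks) = k.u * (k.T - xv p c₁) + eS p c₁ ks := by simp [eS]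

/-- `ℬ ≥ 0` for admissible companions. [this work] -/
theorem bS_nonneg {ks : List Comp} (h : ∀ k ∈ ks, Comp.Adm p c₁ k) : 0 ≤ bS ks := by
  induction ks with
  | nil => simp
  | cons k ks ih =>
    rw [bS_cons]
    have hk := h k (by simp)
    have := ih (fun l hl => h l (by simp [hl]))
    have : 0 ≤ k.u * k.e := mul_nonneg hk.u_nonneg (mul_nonneg hk.A_nonneg hk.c_nonneg)
    linarith

/-- `E ≥ 0` for admissible companions. [this work] -/
theorem eS_nonneg {ks : List Comp} (h : ∀ k ∈ ks, Comp.Adm p c₁ k) : 0 ≤ eS p c₁ ks := by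
  induction ks with
  | nil => simp
  | cons k ks ih =>
    rw [eS_cons]
    have hk := h k (by simp)
    have := ih (fun l hl => h l (by simp [hl]))
    have : 0 ≤ k.u * (k.T - xv p c₁) := mul_nonneg hk.u_nonneg (by linarith [hk.x_le_T])
    linarith

/-- `σ ≥ (length)·x`, in the form used: a non-empty admissible list has `σ ≥ x`, and `σ ≥ 0` always when `x ≥ 0`. [this work] -/
theorem sigS_ge {ks : List Comp} (h : ∀ k ∈ ks, Comp.Adm p c₁ k) (hx : 0 ≤ xv p c₁) :
    0 ≤ sigS ks ∧ (ks ≠ [] → xv p c₁ ≤ sigS ks) := by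
  induction ks with
  | nil => simp
  | cons k ks ih =>
    have hk := h k (by simp)
    have ih' := ih (fun l hl => h l (by simp [hl]))
    refine ⟨?_, fun _ => ?_⟩ <;> rw [sigS_cons] <;> linarith [hk.x_le_T, ih'.1]

end lemmas

/-- The recursion of `M` along the list: `M(k :: ks) = M(ks) + u_k·J − T_k·C` with `J = (1−x) I_k + (1−σ)(T_k − x) − (σ−x) e_k` and
`C = x + ℬ' + E'` (primes = the list `ks`). [this work] -/
theorem omegaM_cons (k : Comp) (ks : List Comp) :
    omegaM p c₁ (k :: ks) = omegaM p c₁ ks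
      + k.u * ((1 - xv p c₁) * inc p c₁ k ks + (1 - (k.T + sigS ks)) * (k.T - xv p c₁) - (k.T + sigS ks - xv p c₁) * k.e)
      - k.T * (xv p c₁ + bS ks + eS p c₁ ks) := by
  simp only [omegaM, piS_cons, bS_cons, sigS_cons, eS_cons]
  ring

/-- Base case: for a single companion `M = (T − x)·(u p c + T − x)`. [this work] -/
theorem omegaM_singleton (k : Comp) (hk : Comp.Adm p c₁ k) :
    omegaM p c₁ [k] = (k.T - xv p c₁) * (k.u * p * k.c + k.T - xv p c₁) := by
  have h := hk.odds
  simp only [omegaM, piS_cons, piS_nil, inc_nil, bS_cons, bS_nil, sigS_cons, sigS_nil, eS_cons, eS_nil, Comp.e,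
    Comp.rho, xv] at h ⊢
  linear_combination (k.T - (1 - p * c₁)) * h

/-- The per-companion identity behind the tied-removal step: with `k` the nearest companion and `l` a later one,
`(1−x) u_l Φ_kl − d_k u_l e_l − d_k u_l (T_l − x) − T_l e_k = (p − A_k) d_k c_l u_l + A_k c_k ((A_l − A_k) c_l u_l + u_l (T_l − x)) + d_k T_l`
(uses only `u_l (ρ_l − T_l) = T_l`). [this work] -/
theorem compTerm_eq (k l : Comp) (hl : Comp.Adm p c₁ l) :
    (1 - xv p c₁) * (l.u * Comp.phi p c₁ k l) - k.d p c₁ * (l.u * l.e) - k.d p c₁ * (l.u * (l.T - xv p c₁)) - l.T * k.e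
      = (p - k.A) * k.d p c₁ * l.c * l.u + k.A * k.c * ((l.A - k.A) * l.c * l.u + l.u * (l.T - xv p c₁)) + k.d p c₁ * l.T := by
  have h := hl.odds
  simp only [Comp.phi, Comp.d, Comp.e, Comp.rho, xv] at h ⊢
  linear_combination (p * (c₁ - k.c) - k.A * k.c + k.A * k.c) * h

/-- Tied removal of the nearest companion does not increase `M`: for the nearest companion `k` (with `p ≥ A_k`, `d_k ≥ 0`) and an admissible
later list `ks` whose prefix drops are `≥ A_k`,  `d_k·σ' ≤ (1−x)·I_k − σ'·e_k − d_k·(ℬ' + E')`. [this work] -/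
theorem tied_removal_aux (k : Comp) (hkA : 0 ≤ k.A) (hkc : 0 ≤ k.c) (hpA : k.A ≤ p) (hd : 0 ≤ k.d p c₁)
    (ks : List Comp) (h : ∀ l ∈ ks, Comp.Adm p c₁ l) (hA : ∀ l ∈ ks, k.A ≤ l.A) :
    k.d p c₁ * sigS ks ≤ (1 - xv p c₁) * inc p c₁ k ks - sigS ks * k.e - k.d p c₁ * (bS ks + eS p c₁ ks) := by
  induction ks with
  | nil => simp
  | cons l ls ih =>
    have hl := h l (by simp)
    have hAl := hA l (by simp)
    have ih' := ih (fun m hm => h m (by simp [hm])) (fun m hm => hA m (by simp [hm]))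
    have hid := compTerm_eq (p := p) (c₁ := c₁) k l hl
    have h1 : 0 ≤ (p - k.A) * k.d p c₁ * l.c * l.u :=
      mul_nonneg (mul_nonneg (mul_nonneg (by linarith) hd) hl.c_nonneg) hl.u_nonneg
    have h2 : 0 ≤ k.A * k.c * ((l.A - k.A) * l.c * l.u + l.u * (l.T - xv p c₁)) :=
      mul_nonneg (mul_nonneg hkA hkc)
        (add_nonneg (mul_nonneg (mul_nonneg (by linarith) hl.c_nonneg) hl.u_nonneg)
          (mul_nonneg hl.u_nonneg (by linarith [hl.x_le_T])))
    rw [sigS_cons, inc_cons, bS_cons, eS_cons]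
    nlinarith [hid, h1, h2, ih']

/-- The step identity: `J − r C = Q₀ + (T − x)·((1 − σ) + (C − e))`, where `Q₀ = (1−x) I − σ' e − d C` is the value of `J − r C` at the tie
`T = x`, `r = ρ − T`, `σ = T + σ'`, `C = x + ℬ' + E'`. [this work] -/
theorem step_identity (k : Comp) (I σ' C : ℝ) :
    ((1 - xv p c₁) * I + (1 - (k.T + σ')) * (k.T - xv p c₁) - (k.T + σ' - xv p c₁) * k.e) - (k.rho p - k.T) * C
      = ((1 - xv p c₁) * I - σ' * k.e - k.d p c₁ * C) + (k.T - xv p c₁) * ((1 - (k.T + σ')) + (C - k.e)) := by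
  simp only [Comp.rho, Comp.d, Comp.e, xv]
  ring

/-- In a list with at least two admissible companions and `σ ≤ 1` one has `x ≤ 1/2`, hence `p ≥ 1/2 ≥ 1 − p ≥ A` for every companion. [this work] -/
theorem A_le_p_of_two (hp : 0 ≤ p) (hc₁1 : c₁ ≤ 1) (k l : Comp) (hk : Comp.Adm p c₁ k) (hl : Comp.Adm p c₁ l)
    (hσ : k.T + l.T ≤ 1) : k.A ≤ p := by
  have hx1 := hk.x_le_T; have hx2 := hl.x_le_T
  simp only [xv] at hx1 hx2
  have : p * c₁ ≤ p := by nlinarith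
  linarith [hk.A_le]

/-- **LEMMA (ΩB\*)** (memo §3; p1 g17).  For `0 ≤ p ≤ 1`, `0 ≤ c₁ ≤ 1`, a non-empty nearest-first list of admissible companions with non-decreasing
prefix drops and total mass `σ ≤ 1`:  `0 ≤ M = (1 − x) Π + (1 − σ) E − (σ − x)(x + ℬ)`.  (`0 ≤ c₁` is not needed.) [this work] -/
theorem omegaM_nonneg (hp : 0 ≤ p) (hp1 : p ≤ 1) (hc₁1 : c₁ ≤ 1) :
    ∀ (ks : List Comp), ks ≠ [] → (∀ k ∈ ks, Comp.Adm p c₁ k) → ks.Pairwise (fun j k => j.A ≤ k.A) →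
      sigS ks ≤ 1 → 0 ≤ omegaM p c₁ ks := by
  intro ks
  induction ks with
  | nil => intro h; exact absurd rfl h
  | cons k ks ih =>
    intro _ hadm hpw hσ
    have hk := hadm k (by simp)
    have hx0 : 0 ≤ xv p c₁ := by simp only [xv]; nlinarith
    rcases List.pairwise_cons.mp hpw with ⟨hkA, hpw'⟩
    by_cases hks : ks = []
    · subst hks
      rw [omegaM_singleton k hk]
      exact mul_nonneg (by linarith [hk.x_le_T])
        (by nlinarith [hk.u_nonneg, hk.c_nonneg, hk.x_le_T, mul_nonneg (mul_nonneg hk.u_nonneg hp) hk.c_nonneg])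
    · have hadm' : ∀ l ∈ ks, Comp.Adm p c₁ l := fun l hl => hadm l (by simp [hl])
      have hσ' : sigS ks ≤ 1 := by rw [sigS_cons] at hσ; linarith [hk.x_le_T]
      have ih' := ih hks hadm' hpw' hσ'
      obtain ⟨l, ls, rfl⟩ := List.exists_cons_of_ne_nil hks
      have hl := hadm' l (by simp)
      -- p ≥ A_k from 2x ≤ σ ≤ 1
      have hσ2 : k.T + l.T ≤ 1 := by
        rw [sigS_cons, sigS_cons] at hσ
        have := (sigS_ge (ks := ls) (fun m hm => hadm' m (by simp [hm])) hx0).1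
        linarith
      have hpA : k.A ≤ p := A_le_p_of_two hp hc₁1 k l hk hl hσ2
      have hd : 0 ≤ k.d p c₁ := by
        have := hk.T_le_rho; have := hk.x_le_T
        simp only [Comp.d, Comp.rho, xv] at *; linarith
      have haux := tied_removal_aux k hk.A_nonneg hk.c_nonneg hpA hd (l :: ls) hadm' hkA
      have hsig := sigS_ge (ks := l :: ls) hadm' hx0
      have hσx : xv p c₁ ≤ sigS (l :: ls) := hsig.2 (by simp)
      have hB := bS_nonneg (ks := l :: ls) hadm'
      have hE := eS_nonneg (ks := l :: ls) hadm'
      have hex : k.e ≤ xv p c₁ := by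
        have : k.A * k.c ≤ (1 - p) * c₁ := by nlinarith [hk.A_le, hk.c_le, hk.A_nonneg, hk.c_nonneg]
        simp only [Comp.e, xv]; nlinarith
      -- assemble
      rw [omegaM_cons]
      set I := inc p c₁ k (l :: ls)
      set σ' := sigS (l :: ls)
      set C := xv p c₁ + bS (l :: ls) + eS p c₁ (l :: ls)
      have hstep := step_identity (p := p) (c₁ := c₁) k I σ' C
      have hQ0 : 0 ≤ (1 - xv p c₁) * I - σ' * k.e - k.d p c₁ * C := by
        have : k.d p c₁ * xv p c₁ ≤ k.d p c₁ * σ' := mul_le_mul_of_nonneg_left hσx hd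
        simp only [C]; nlinarith [haux, this]
      have hfac : 0 ≤ (k.T - xv p c₁) * ((1 - (k.T + σ')) + (C - k.e)) := by
        apply mul_nonneg (by linarith [hk.x_le_T])
        have : k.T + σ' ≤ 1 := by simpa [σ', sigS_cons] using hσ
        simp only [C]; linarith
      have hJ : 0 ≤ ((1 - xv p c₁) * I + (1 - (k.T + σ')) * (k.T - xv p c₁) - (k.T + σ' - xv p c₁) * k.e)
          - (k.rho p - k.T) * C := by rw [hstep]; linarith
      -- u·J − T·C = u·(J − r C) by the odds relation
      have hodds := hk.odds
      nlinarith [mul_nonneg hk.u_nonneg hJ, hodds, ih']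

/-! ## The two-sided coupling (memo §2): real algebra on the side aggregates

For the distinguished relay at an interior position the two-sided pairs polynomial is `Ω_L + Ω_R + C` with `Ω_S = Π_S − ℬ_S` the
one-sided polynomials of the two sides (each a one-sided pairs system with the same `x`, `1 − x = p_L p_R`) and cross term
`C = P_L P_R / (1 − x)`, `P_S = Σ u (d + e) ≥ σ_S`.  Multiplying by `1 − x`, "`Ω_L + Ω_R + C ≥ x`" is the conclusion below. -/

/-- **Two-sided coupling, both sides subcritical.**  From the (ΩB\*) margins of the two sides
(`(1−x)(Ω_S − x) + (1−σ_S)(P_S − σ_S + x) ≥ 0`), `P_S ≥ σ_S ≥ x`, `σ_S ≤ 1` and `σ_L + σ_R ≥ 1`: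
`(1−x)(Ω_L + Ω_R − x) + P_L P_R ≥ 0`.  Proof: the difference to the two margins is
`x(1−x) + Σ_S (1−σ_S)(σ_S−x) − (1−σ_L)(1−σ_R) + (P_L − (1−σ_R))(P_R − (1−σ_L)) ≥ x(σ_R − x) ≥ 0`. [this work] -/
theorem twoSided_coupling {x σL σR PL PR ΩL ΩR : ℝ} (hx : 0 ≤ x)
    (hML : 0 ≤ (1 - x) * (ΩL - x) + (1 - σL) * (PL - σL + x))
    (hMR : 0 ≤ (1 - x) * (ΩR - x) + (1 - σR) * (PR - σR + x))
    (hPL : σL ≤ PL) (hPR : σR ≤ PR) (hxL : x ≤ σL) (hxR : x ≤ σR) (hL1 : σL ≤ 1) (hR1 : σR ≤ 1)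
    (hsum : 1 ≤ σL + σR) :
    0 ≤ (1 - x) * (ΩL + ΩR - x) + PL * PR := by
  have h1 : 0 ≤ (PL - (1 - σR)) * (PR - (1 - σL)) := mul_nonneg (by linarith) (by linarith)
  have h2 : 0 ≤ (1 - σL) * (σL - x) := mul_nonneg (by linarith) (by linarith)
  have h3 : 0 ≤ (1 - σR) * (σL + σR - 1) := mul_nonneg (by linarith) (by linarith)
  have h4 : 0 ≤ x * (σR - x) := mul_nonneg hx (by linarith)
  nlinarith [hML, hMR, h1, h2, h3, h4]

/-- **Two-sided coupling, one side supercritical.**  If the right subsystem satisfies the one-sided regime-A inequality `Ω_R ≥ x`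
and `P_R ≥ 1` (as when `σ_R ≥ 1`), then with `Π_L ≥ 0` and `0 ≤ ℬ_L ≤ P_L`: `(1−x)(Π_L − ℬ_L + Ω_R − x) + P_L P_R ≥ 0`
(the cross term pays the left singletons: `C ≥ P_L ≥ ℬ_L`). [this work] -/
theorem twoSided_coupling_super {x PiL BL PL PR ΩR : ℝ} (hx : 0 ≤ x) (hx1 : x ≤ 1)
    (hΩR : x ≤ ΩR) (hPR : 1 ≤ PR) (hPiL : 0 ≤ PiL) (hBL : 0 ≤ BL) (hBP : BL ≤ PL) :
    0 ≤ (1 - x) * (PiL - BL + ΩR - x) + PL * PR := by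
  have h1 : 0 ≤ (1 - x) * PiL := mul_nonneg (by linarith) hPiL
  have h2 : 0 ≤ (1 - x) * (ΩR - x) := mul_nonneg (by linarith) (by linarith)
  have h3 : PL ≤ PL * PR := by nlinarith
  have h4 : 0 ≤ x * BL := mul_nonneg hx hBL
  nlinarith [h1, h2, h3, h4]

end TwoArc

end Quant

end Summit.CriticalPhenomena.PercolationContinuityZ3.Theorems
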